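import Summits.ResolutionOfSingularities.ResolutionOfSingularities.Theorems.ConeExit.Negative.ContactStart

/-!
# `ConeExit` (crux stmt-ResolutionOfSingularities-16883, route `WildCones`):
# the hypothesis `p ≠ 2` is LOAD-BEARING at the level of the crux itself (negative-side support,
# refuter cdisprove seat; this file refutes nothing stated in the route — `ConeExit` carries `p ≠ 2`)

`Negative/ChernFalseAtTwo.lean` records that the MECHANISM (the critical-direction lemma) fails at
`p = 2`. This file records the failure of the CRUX BODY itself at `p = 2`, through the crux's own
formal calculus (exact mirror `Negative/Mirror.lean`, `crux_iff`): the right-hand side of `crux_iff`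
with the hypothesis `p ≠ 2` deleted and nothing else changed is FALSE (`coneExit_false_without_PNe2`,
stated inline). Witness (the planner's contact form): `p = 2`, `n = 4`, `κ = 𝔽₂`,
`a = u₁u₂ + u₃²u₄ + u₄⁵ + u₃⁷` (`Negative/ContactStart.lean`), chart `u₃`, translation `0`.
`step_contact` computes the successor `u₁u₂ + u₃u₄ + u₃⁵ + u₃³u₄⁵` through `clean ∘ tr ∘ dv ∘ bl ∘ clean`;
`isol_contact'` (`(∂a') = 𝔪`, via the unit `1 + u₃²u₄⁴`) certifies its isolatedness in the kernel; with
`two_le_dL_contact` all four hypotheses of the crux hold and the conclusion `dL c = 1` fails. The parity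
enters the cone-forcing mechanism exactly through `Crit(u₁u₂) = {0}` (contact form, `s = 2` even).
-/

noncomputable section

-- single-problem summit: the doubled namespace component `ResolutionOfSingularities` is forced by the tree layout
set_option linter.dupNamespace false

namespace Summit.ResolutionOfSingularities.ResolutionOfSingularities.Theorems.ConeExit.Negative

open scoped BigOperators Classical
open MvPowerSeries

/-- Its successor in the `u₃`-chart at translation `0`: `a' = u₁u₂ + u₃u₄ + u₃⁵ + u₃³u₄⁵`, as a coefficient
function. [folklore] -/
def contact' : (Fin 4 → ℕ) → ZMod 2 :=
  fun A =>
    if A 0 = 0 ∧ A 1 = 0 ∧ A 2 = 1 ∧ A 3 = 1 then 1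
    else if A 0 = 0 ∧ A 1 = 0 ∧ A 2 = 3 ∧ A 3 = 5 then 1
    else if A 0 = 0 ∧ A 1 = 0 ∧ A 2 = 5 ∧ A 3 = 0 then 1
    else if A 0 = 1 ∧ A 1 = 1 ∧ A 2 = 0 ∧ A 3 = 0 then 1
    else 0


/-- Support of `contact'`. [folklore] -/
lemma contact'_ne_zero_iff (A : Fin 4 → ℕ) :
    contact' A ≠ 0 ↔
      (A 0 = 0 ∧ A 1 = 0 ∧ A 2 = 1 ∧ A 3 = 1) ∨
      (A 0 = 0 ∧ A 1 = 0 ∧ A 2 = 3 ∧ A 3 = 5) ∨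
      (A 0 = 0 ∧ A 1 = 0 ∧ A 2 = 5 ∧ A 3 = 0) ∨
      (A 0 = 1 ∧ A 1 = 1 ∧ A 2 = 0 ∧ A 3 = 0) := by
  constructor
  · intro h
    unfold contact' at h
    split_ifs at h with h1 h2 h3 h4
    · exact Or.inl h1
    · exact Or.inr (Or.inl h2)
    · exact Or.inr (Or.inr (Or.inl h3))
    · exact Or.inr (Or.inr (Or.inr h4))
    · exact absurd rfl h
  · intro h
    unfold contact'
    split_ifs <;> first | exact one_ne_zero | (exfalso; omega)


/-- `contact'` is `2`-clean (every monomial has an odd exponent). [folklore] -/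
lemma clean_contact' : clean 2 contact' = contact' := by
  funext A
  unfold clean
  split_ifs with h
  · symm
    by_contra hne
    rcases (contact'_ne_zero_iff A).mp hne with hA | hA | hA | hA
    · have := h 2; omega
    · have := h 2; omega
    · have := h 2; omega
    · have := h 0; omega
  · rfl


/-- `∂_0` of `contact'` over `𝔽₂`. [folklore] -/
lemma pd0_contact' : pd 0 (ser 2 contact') = (X 1 : MvPowerSeries (Fin 4) (ZMod 2)) := by
  ext A
  rw [coeff_pd_ser, coeff_ser, clean_contact', coeff_X]
  have e0 : (A + Finsupp.single (0 : Fin 4) 1 : Fin 4 →₀ ℕ) 0 = A 0 + 1 := by simp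
  have e1 : (A + Finsupp.single (0 : Fin 4) 1 : Fin 4 →₀ ℕ) 1 = A 1 := by simp
  have e2 : (A + Finsupp.single (0 : Fin 4) 1 : Fin 4 →₀ ℕ) 2 = A 2 := by simp
  have e3 : (A + Finsupp.single (0 : Fin 4) 1 : Fin 4 →₀ ℕ) 3 = A 3 := by simp
  have hT0 : A = Finsupp.single (1 : Fin 4) 1 ↔ A 0 = 0 ∧ A 1 = 1 ∧ A 2 = 0 ∧ A 3 = 0 := by
    constructor
    · intro h; subst h; simp
    · rintro ⟨h0, h1, h2, h3⟩; ext j; fin_cases j <;> simp [h0, h1, h2, h3]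
  unfold contact'
  simp only [e0, e1, e2, e3]
  by_cases hc0 : A 0 = 0 ∧ A 1 = 1 ∧ A 2 = 0 ∧ A 3 = 0
  · rw [if_pos (hT0.mpr hc0),
      if_neg (show ¬ (A 0 + 1 = 0 ∧ A 1 = 0 ∧ A 2 = 1 ∧ A 3 = 1) by omega),
      if_neg (show ¬ (A 0 + 1 = 0 ∧ A 1 = 0 ∧ A 2 = 3 ∧ A 3 = 5) by omega),
      if_neg (show ¬ (A 0 + 1 = 0 ∧ A 1 = 0 ∧ A 2 = 5 ∧ A 3 = 0) by omega),
      if_pos (show A 0 + 1 = 1 ∧ A 1 = 1 ∧ A 2 = 0 ∧ A 3 = 0 by omega)]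
    rw [show A 0 = 0 by omega]; decide
  · rw [if_neg (show ¬ (A = Finsupp.single (1 : Fin 4) 1) from fun h' => by have := hT0.mp h'; omega),
      if_neg (show ¬ (A 0 + 1 = 0 ∧ A 1 = 0 ∧ A 2 = 1 ∧ A 3 = 1) by omega),
      if_neg (show ¬ (A 0 + 1 = 0 ∧ A 1 = 0 ∧ A 2 = 3 ∧ A 3 = 5) by omega),
      if_neg (show ¬ (A 0 + 1 = 0 ∧ A 1 = 0 ∧ A 2 = 5 ∧ A 3 = 0) by omega),
      if_neg (show ¬ (A 0 + 1 = 1 ∧ A 1 = 1 ∧ A 2 = 0 ∧ A 3 = 0) by omega),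
      mul_zero]

/-- `∂_1` of `contact'` over `𝔽₂`. [folklore] -/
lemma pd1_contact' : pd 1 (ser 2 contact') = (X 0 : MvPowerSeries (Fin 4) (ZMod 2)) := by
  ext A
  rw [coeff_pd_ser, coeff_ser, clean_contact', coeff_X]
  have e0 : (A + Finsupp.single (1 : Fin 4) 1 : Fin 4 →₀ ℕ) 0 = A 0 := by simp
  have e1 : (A + Finsupp.single (1 : Fin 4) 1 : Fin 4 →₀ ℕ) 1 = A 1 + 1 := by simp
  have e2 : (A + Finsupp.single (1 : Fin 4) 1 : Fin 4 →₀ ℕ) 2 = A 2 := by simp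
  have e3 : (A + Finsupp.single (1 : Fin 4) 1 : Fin 4 →₀ ℕ) 3 = A 3 := by simp
  have hT0 : A = Finsupp.single (0 : Fin 4) 1 ↔ A 0 = 1 ∧ A 1 = 0 ∧ A 2 = 0 ∧ A 3 = 0 := by
    constructor
    · intro h; subst h; simp
    · rintro ⟨h0, h1, h2, h3⟩; ext j; fin_cases j <;> simp [h0, h1, h2, h3]
  unfold contact'
  simp only [e0, e1, e2, e3]
  by_cases hc0 : A 0 = 1 ∧ A 1 = 0 ∧ A 2 = 0 ∧ A 3 = 0
  · rw [if_pos (hT0.mpr hc0),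
      if_neg (show ¬ (A 0 = 0 ∧ A 1 + 1 = 0 ∧ A 2 = 1 ∧ A 3 = 1) by omega),
      if_neg (show ¬ (A 0 = 0 ∧ A 1 + 1 = 0 ∧ A 2 = 3 ∧ A 3 = 5) by omega),
      if_neg (show ¬ (A 0 = 0 ∧ A 1 + 1 = 0 ∧ A 2 = 5 ∧ A 3 = 0) by omega),
      if_pos (show A 0 = 1 ∧ A 1 + 1 = 1 ∧ A 2 = 0 ∧ A 3 = 0 by omega)]
    rw [show A 1 = 0 by omega]; decide
  · rw [if_neg (show ¬ (A = Finsupp.single (0 : Fin 4) 1) from fun h' => by have := hT0.mp h'; omega),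
      if_neg (show ¬ (A 0 = 0 ∧ A 1 + 1 = 0 ∧ A 2 = 1 ∧ A 3 = 1) by omega),
      if_neg (show ¬ (A 0 = 0 ∧ A 1 + 1 = 0 ∧ A 2 = 3 ∧ A 3 = 5) by omega),
      if_neg (show ¬ (A 0 = 0 ∧ A 1 + 1 = 0 ∧ A 2 = 5 ∧ A 3 = 0) by omega),
      if_neg (show ¬ (A 0 = 1 ∧ A 1 + 1 = 1 ∧ A 2 = 0 ∧ A 3 = 0) by omega),
      mul_zero]

/-- `∂_2` of `contact'` over `𝔽₂`. [folklore] -/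
lemma pd2_contact' : pd 2 (ser 2 contact') = (X 3 : MvPowerSeries (Fin 4) (ZMod 2)) + X 2 ^ 2 * X 3 ^ 5 + X 2 ^ 4 := by
  ext A
  rw [coeff_pd_ser, coeff_ser, clean_contact', map_add, map_add, coeff_X, coeff_X_pow_mul', coeff_X_pow]
  have e0 : (A + Finsupp.single (2 : Fin 4) 1 : Fin 4 →₀ ℕ) 0 = A 0 := by simp
  have e1 : (A + Finsupp.single (2 : Fin 4) 1 : Fin 4 →₀ ℕ) 1 = A 1 := by simp
  have e2 : (A + Finsupp.single (2 : Fin 4) 1 : Fin 4 →₀ ℕ) 2 = A 2 + 1 := by simp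
  have e3 : (A + Finsupp.single (2 : Fin 4) 1 : Fin 4 →₀ ℕ) 3 = A 3 := by simp
  have hT0 : A = Finsupp.single (3 : Fin 4) 1 ↔ A 0 = 0 ∧ A 1 = 0 ∧ A 2 = 0 ∧ A 3 = 1 := by
    constructor
    · intro h; subst h; simp
    · rintro ⟨h0, h1, h2, h3⟩; ext j; fin_cases j <;> simp [h0, h1, h2, h3]
  have hT1 : A = Finsupp.single (2 : Fin 4) 2 + Finsupp.single (3 : Fin 4) 5 ↔ A 0 = 0 ∧ A 1 = 0 ∧ A 2 = 2 ∧ A 3 = 5 := by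
    constructor
    · intro h; subst h; simp
    · rintro ⟨h0, h1, h2, h3⟩; ext j; fin_cases j <;> simp [h0, h1, h2, h3]
  have hT2 : A = Finsupp.single (2 : Fin 4) 4 ↔ A 0 = 0 ∧ A 1 = 0 ∧ A 2 = 4 ∧ A 3 = 0 := by
    constructor
    · intro h; subst h; simp
    · rintro ⟨h0, h1, h2, h3⟩; ext j; fin_cases j <;> simp [h0, h1, h2, h3]
  unfold contact'
  simp only [e0, e1, e2, e3]
  by_cases hc0 : A 0 = 0 ∧ A 1 = 0 ∧ A 2 = 0 ∧ A 3 = 1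
  · rw [if_pos (hT0.mpr hc0),
      if_neg (show ¬ (A = Finsupp.single (2 : Fin 4) 2 + Finsupp.single (3 : Fin 4) 5) from fun h' => by have := hT1.mp h'; omega),
      if_neg (show ¬ (A = Finsupp.single (2 : Fin 4) 4) from fun h' => by have := hT2.mp h'; omega),
      if_pos (show A 0 = 0 ∧ A 1 = 0 ∧ A 2 + 1 = 1 ∧ A 3 = 1 by omega)]
    rw [show A 2 = 0 by omega]; decide
  · by_cases hc1 : A 0 = 0 ∧ A 1 = 0 ∧ A 2 = 2 ∧ A 3 = 5
    · rw [if_neg (show ¬ (A = Finsupp.single (3 : Fin 4) 1) from fun h' => by have := hT0.mp h'; omega),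
        if_pos (hT1.mpr hc1),
        if_neg (show ¬ (A = Finsupp.single (2 : Fin 4) 4) from fun h' => by have := hT2.mp h'; omega),
        if_neg (show ¬ (A 0 = 0 ∧ A 1 = 0 ∧ A 2 + 1 = 1 ∧ A 3 = 1) by omega),
        if_pos (show A 0 = 0 ∧ A 1 = 0 ∧ A 2 + 1 = 3 ∧ A 3 = 5 by omega)]
      rw [show A 2 = 2 by omega]; decide
    · by_cases hc2 : A 0 = 0 ∧ A 1 = 0 ∧ A 2 = 4 ∧ A 3 = 0
      · rw [if_neg (show ¬ (A = Finsupp.single (3 : Fin 4) 1) from fun h' => by have := hT0.mp h'; omega),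
          if_neg (show ¬ (A = Finsupp.single (2 : Fin 4) 2 + Finsupp.single (3 : Fin 4) 5) from fun h' => by have := hT1.mp h'; omega),
          if_pos (hT2.mpr hc2),
          if_neg (show ¬ (A 0 = 0 ∧ A 1 = 0 ∧ A 2 + 1 = 1 ∧ A 3 = 1) by omega),
          if_neg (show ¬ (A 0 = 0 ∧ A 1 = 0 ∧ A 2 + 1 = 3 ∧ A 3 = 5) by omega),
          if_pos (show A 0 = 0 ∧ A 1 = 0 ∧ A 2 + 1 = 5 ∧ A 3 = 0 by omega)]
        rw [show A 2 = 4 by omega]; decide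
      · rw [if_neg (show ¬ (A = Finsupp.single (3 : Fin 4) 1) from fun h' => by have := hT0.mp h'; omega),
          if_neg (show ¬ (A = Finsupp.single (2 : Fin 4) 2 + Finsupp.single (3 : Fin 4) 5) from fun h' => by have := hT1.mp h'; omega),
          if_neg (show ¬ (A = Finsupp.single (2 : Fin 4) 4) from fun h' => by have := hT2.mp h'; omega),
          if_neg (show ¬ (A 0 = 0 ∧ A 1 = 0 ∧ A 2 + 1 = 1 ∧ A 3 = 1) by omega),
          if_neg (show ¬ (A 0 = 0 ∧ A 1 = 0 ∧ A 2 + 1 = 3 ∧ A 3 = 5) by omega),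
          if_neg (show ¬ (A 0 = 0 ∧ A 1 = 0 ∧ A 2 + 1 = 5 ∧ A 3 = 0) by omega),
          if_neg (show ¬ (A 0 = 1 ∧ A 1 = 1 ∧ A 2 + 1 = 0 ∧ A 3 = 0) by omega),
          mul_zero,
          add_zero,
          add_zero]

/-- `∂_3` of `contact'` over `𝔽₂`. [folklore] -/
lemma pd3_contact' : pd 3 (ser 2 contact') = (X 2 : MvPowerSeries (Fin 4) (ZMod 2)) + X 2 ^ 3 * X 3 ^ 4 := by
  ext A
  rw [coeff_pd_ser, coeff_ser, clean_contact', map_add, coeff_X, coeff_X_pow_mul']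
  have e0 : (A + Finsupp.single (3 : Fin 4) 1 : Fin 4 →₀ ℕ) 0 = A 0 := by simp
  have e1 : (A + Finsupp.single (3 : Fin 4) 1 : Fin 4 →₀ ℕ) 1 = A 1 := by simp
  have e2 : (A + Finsupp.single (3 : Fin 4) 1 : Fin 4 →₀ ℕ) 2 = A 2 := by simp
  have e3 : (A + Finsupp.single (3 : Fin 4) 1 : Fin 4 →₀ ℕ) 3 = A 3 + 1 := by simp
  have hT0 : A = Finsupp.single (2 : Fin 4) 1 ↔ A 0 = 0 ∧ A 1 = 0 ∧ A 2 = 1 ∧ A 3 = 0 := by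
    constructor
    · intro h; subst h; simp
    · rintro ⟨h0, h1, h2, h3⟩; ext j; fin_cases j <;> simp [h0, h1, h2, h3]
  have hT1 : A = Finsupp.single (2 : Fin 4) 3 + Finsupp.single (3 : Fin 4) 4 ↔ A 0 = 0 ∧ A 1 = 0 ∧ A 2 = 3 ∧ A 3 = 4 := by
    constructor
    · intro h; subst h; simp
    · rintro ⟨h0, h1, h2, h3⟩; ext j; fin_cases j <;> simp [h0, h1, h2, h3]
  unfold contact'
  simp only [e0, e1, e2, e3]
  by_cases hc0 : A 0 = 0 ∧ A 1 = 0 ∧ A 2 = 1 ∧ A 3 = 0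
  · rw [if_pos (hT0.mpr hc0),
      if_neg (show ¬ (A = Finsupp.single (2 : Fin 4) 3 + Finsupp.single (3 : Fin 4) 4) from fun h' => by have := hT1.mp h'; omega),
      if_pos (show A 0 = 0 ∧ A 1 = 0 ∧ A 2 = 1 ∧ A 3 + 1 = 1 by omega)]
    rw [show A 3 = 0 by omega]; decide
  · by_cases hc1 : A 0 = 0 ∧ A 1 = 0 ∧ A 2 = 3 ∧ A 3 = 4
    · rw [if_neg (show ¬ (A = Finsupp.single (2 : Fin 4) 1) from fun h' => by have := hT0.mp h'; omega),
        if_pos (hT1.mpr hc1),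
        if_neg (show ¬ (A 0 = 0 ∧ A 1 = 0 ∧ A 2 = 1 ∧ A 3 + 1 = 1) by omega),
        if_pos (show A 0 = 0 ∧ A 1 = 0 ∧ A 2 = 3 ∧ A 3 + 1 = 5 by omega)]
      rw [show A 3 = 4 by omega]; decide
    · rw [if_neg (show ¬ (A = Finsupp.single (2 : Fin 4) 1) from fun h' => by have := hT0.mp h'; omega),
        if_neg (show ¬ (A = Finsupp.single (2 : Fin 4) 3 + Finsupp.single (3 : Fin 4) 4) from fun h' => by have := hT1.mp h'; omega),
        if_neg (show ¬ (A 0 = 0 ∧ A 1 = 0 ∧ A 2 = 1 ∧ A 3 + 1 = 1) by omega),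
        if_neg (show ¬ (A 0 = 0 ∧ A 1 = 0 ∧ A 2 = 3 ∧ A 3 + 1 = 5) by omega),
        if_neg (show ¬ (A 0 = 0 ∧ A 1 = 0 ∧ A 2 = 5 ∧ A 3 + 1 = 0) by omega),
        if_neg (show ¬ (A 0 = 1 ∧ A 1 = 1 ∧ A 2 = 0 ∧ A 3 + 1 = 0) by omega),
        mul_zero,
        add_zero]

/-- `contact'` has multiplicity `2`. [folklore] -/
lemma multP_contact' : (∃ A, clean 2 contact' A ≠ 0) ∧
    ∀ A, clean 2 contact' A ≠ 0 → 2 ≤ Finset.sum Finset.univ (fun j => A j) := by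
  rw [clean_contact']
  refine ⟨⟨![1, 1, 0, 0], (contact'_ne_zero_iff _).mpr (by right; right; right; simp)⟩, ?_⟩
  intro A hA
  rw [Fin.sum_univ_four]
  rcases (contact'_ne_zero_iff A).mp hA with h | h | h | h <;> omega

/-- **One step of the dynamics** (chart `u₃`, translation `0`) maps `contact` to `contact'`:
`u₁u₂ + u₃²u₄ + u₄⁵ + u₃⁷ ↦ (u₃²u₁u₂ + u₃³u₄ + u₃⁵u₄⁵ + u₃⁷)/u₃² = u₁u₂ + u₃u₄ + u₃³u₄⁵ + u₃⁵`,
already clean. [folklore] -/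
lemma step_contact : step 2 (2 : Fin 4) (0 : Fin 4 → ZMod 2) contact = contact' := by
  unfold step
  rw [clean_contact, if_pos two_le_ord_contact, tr_zero]
  funext B
  have hsum : ∀ B : Fin 4 → ℕ,
      Finset.sum (Finset.univ.erase (2 : Fin 4)) (fun j => B j) = B 0 + B 1 + B 3 := by
    intro B
    have h := Finset.add_sum_erase Finset.univ (fun j => B j) (Finset.mem_univ (2 : Fin 4))
    rw [Fin.sum_univ_four] at h
    omega
  have h02 : (0 : Fin 4) ≠ 2 := by decide
  have h12 : (1 : Fin 4) ≠ 2 := by decide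
  have h32 : (3 : Fin 4) ≠ 2 := by decide
  have hall : (∀ j : Fin 4, 2 ∣ B j) ↔ 2 ∣ B 0 ∧ 2 ∣ B 1 ∧ 2 ∣ B 2 ∧ 2 ∣ B 3 :=
    ⟨fun h => ⟨h 0, h 1, h 2, h 3⟩, fun h j => by fin_cases j; exacts [h.1, h.2.1, h.2.2.1, h.2.2.2]⟩
  unfold clean dv bl contact contact'
  simp only [hsum, Function.update_self, Function.update_of_ne h02, Function.update_of_ne h12,
    Function.update_of_ne h32, hall]
  split_ifs <;> first | rfl | omega

/-- **`contact'` is ISOLATED** (indeed its Jacobian ideal is the maximal ideal):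
`∂a' = (u₂, u₁, u₄ + u₃²u₄⁵ + u₃⁴, u₃ + u₃³u₄⁴)`, and `1 + u₃²u₄⁴` is a unit of `𝔽₂[[u]]`. [folklore] -/
lemma isol_contact' : Module.Finite (ZMod 2) (MvPowerSeries (Fin 4) (ZMod 2) ⧸ jac 2 contact') := by
  have hJ : ∀ k : Fin 4, pd k (ser 2 contact') ∈ jac 2 contact' := fun k => Ideal.subset_span ⟨k, rfl⟩
  have h0 : (X 1 : MvPowerSeries (Fin 4) (ZMod 2)) ∈ jac 2 contact' := pd0_contact' ▸ hJ 0
  have h1 : (X 0 : MvPowerSeries (Fin 4) (ZMod 2)) ∈ jac 2 contact' := pd1_contact' ▸ hJ 1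
  have h2 : (X 3 : MvPowerSeries (Fin 4) (ZMod 2)) + X 2 ^ 2 * X 3 ^ 5 + X 2 ^ 4 ∈ jac 2 contact' :=
    pd2_contact' ▸ hJ 2
  have h3 : (X 2 : MvPowerSeries (Fin 4) (ZMod 2)) + X 2 ^ 3 * X 3 ^ 4 ∈ jac 2 contact' :=
    pd3_contact' ▸ hJ 3
  -- the unit `u = 1 + X₂²X₃⁴`
  set u : MvPowerSeries (Fin 4) (ZMod 2) := 1 + X 2 ^ 2 * X 3 ^ 4 with hu
  have hu0 : MvPowerSeries.constantCoeff u ≠ 0 := by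
    simp [hu]
  have hX2 : (X 2 : MvPowerSeries (Fin 4) (ZMod 2)) ∈ jac 2 contact' := by
    have : (X 2 : MvPowerSeries (Fin 4) (ZMod 2)) = (X 2 + X 2 ^ 3 * X 3 ^ 4) * u⁻¹ := by
      rw [show (X 2 : MvPowerSeries (Fin 4) (ZMod 2)) + X 2 ^ 3 * X 3 ^ 4 = X 2 * u from by
        rw [hu]; ring, mul_assoc, MvPowerSeries.mul_inv_cancel u hu0, mul_one]
    rw [this]
    exact Ideal.mul_mem_right _ _ h3
  have hX3 : (X 3 : MvPowerSeries (Fin 4) (ZMod 2)) ∈ jac 2 contact' := by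
    have : (X 3 : MvPowerSeries (Fin 4) (ZMod 2)) =
        (X 3 + X 2 ^ 2 * X 3 ^ 5 + X 2 ^ 4) - (X 2 * X 3 ^ 5 + X 2 ^ 3) * X 2 := by ring
    rw [this]
    exact Ideal.sub_mem _ h2 (Ideal.mul_mem_left _ _ hX2)
  apply module_finite_quotient_of_X_pow_mem _ 1
  intro k
  fin_cases k
  · simpa using h1
  · simpa using h0
  · simpa using hX2
  · simpa using hX3


/-- **`p ≠ 2` is load-bearing in `ConeExit`.** The negated proposition is the right-hand side of
`crux_iff` (`Negative/Mirror.lean`) with the hypothesis `p ≠ 2` deleted and nothing else changed; it is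
false at `(p, n, κ) = (2, 4, 𝔽₂)`: the contact-form start `u₁u₂ + u₃²u₄ + u₄⁵ + u₃⁷` and its `u₃`-chart
successor `u₁u₂ + u₃u₄ + u₃⁵ + u₃³u₄⁵` are both isolated of multiplicity `2`, the start has cleaned order
exactly `2`, but `dL = 2 ≠ 1` (the cone `u₁u₂` ignores `u₃, u₄`). [folklore] -/
theorem coneExit_false_without_PNe2 :
    ¬ ∀ p : ℕ, p.Prime → ∀ n : ℕ, 3 ≤ n → ∀ (κ : Type) [Field κ] [CharP κ p] [PerfectField κ]
        (c : (Fin n → ℕ) → κ) (i : Fin n) (τ : Fin n → κ),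
        Module.Finite κ (MvPowerSeries (Fin n) κ ⧸ jac p c) →
        ((∃ A, clean p c A ≠ 0) ∧ ∀ A, clean p c A ≠ 0 → p ≤ Finset.sum Finset.univ (fun j => A j)) →
        Module.Finite κ (MvPowerSeries (Fin n) κ ⧸ jac p (step p i τ c)) →
        ((∃ A, clean p (step p i τ c) A ≠ 0) ∧
          ∀ A, clean p (step p i τ c) A ≠ 0 → p ≤ Finset.sum Finset.univ (fun j => A j)) →
        (∃ A, clean p c A ≠ 0 ∧ Finset.sum Finset.univ (fun j => A j) = p) ∧ dL p c = 1 := by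
  intro h
  have key := h 2 Nat.prime_two 4 (by norm_num) (ZMod 2) contact 2 0 isol_contact multP_contact
    (by rw [step_contact]; exact isol_contact') (by rw [step_contact]; exact multP_contact')
  have := two_le_dL_contact
  omega

/-- The same fact against the crux's body at `p = 2` directly. [folklore] -/
theorem coneExit_body_false_at_p2 :
    ¬ ∀ (κ : Type) [Field κ] [CharP κ 2] [PerfectField κ]
        (c : (Fin 4 → ℕ) → κ) (i : Fin 4) (τ : Fin 4 → κ),
        Module.Finite κ (MvPowerSeries (Fin 4) κ ⧸ jac 2 c) →
        ((∃ A, clean 2 c A ≠ 0) ∧ ∀ A, clean 2 c A ≠ 0 → 2 ≤ Finset.sum Finset.univ (fun j => A j)) →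
        Module.Finite κ (MvPowerSeries (Fin 4) κ ⧸ jac 2 (step 2 i τ c)) →
        ((∃ A, clean 2 (step 2 i τ c) A ≠ 0) ∧
          ∀ A, clean 2 (step 2 i τ c) A ≠ 0 → 2 ≤ Finset.sum Finset.univ (fun j => A j)) →
        (∃ A, clean 2 c A ≠ 0 ∧ Finset.sum Finset.univ (fun j => A j) = 2) ∧ dL 2 c = 1 := by
  intro h
  have key := h (ZMod 2) contact 2 0 isol_contact multP_contact
    (by rw [step_contact]; exact isol_contact') (by rw [step_contact]; exact multP_contact')
  have := two_le_dL_contact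
  omega

end Summit.ResolutionOfSingularities.ResolutionOfSingularities.Theorems.ConeExit.Negative

end
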